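import Mathlib
import Literature.NumberTheory.LFunctions.Zhang2022.TypedSection12A
import Literature.NumberTheory.LFunctions.Zhang2022.Section11SmoothedStep
import HarnessLib

/-!
# Zhang (2022) §12 p. 66–67: the SHARP Gaussian profile of the (12.6) window coefficients `ϰ₁𝟙 − ϰ₁₂`

Topic `Literature/NumberTheory/LFunctions/Zhang2022` (Landau–Siegel audit tree; verdict-neutral).
Y. Zhang, *Discrete mean estimates and the Landau–Siegel zero*, arXiv:2211.02515v1 (2022)
[Zhang2022LandauSiegel] — **an unrefereed manuscript under adjudication; nothing here asserts or
denies its Theorems 1–2.** Helper under the leaf hXi = `Typed.Sec12A.Xi15Hbar16` (cell GAP row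
G-d42-2): the input data for the unprinted estimate "`S_j(𝐛,𝐛̄) = o(α𝔞)`" (the hypothesis `hS` of the
tree's `Typed.Sec12A.eq126_of_sj_small`), where `𝐛` is the coefficient sequence of `H₁₅ − H̃₁₅`:
`𝐛(n) = χ(n)(ϰ₁(n)𝟙[P^{1/2} ≤ n < ⌈P₁⌉] − ϰ₁₂(n)𝟙[P^{0.5}η₋ < n < P₁η₊])`.

The manuscript (p. 66–67, tex L3404–L3408) prices `ϰ₁₂ − ϰ₁` as `≪ ε` in the bulk, `≪ 𝓛⁻¹⁰` on
`[P₁η₋, P₁η₊)` and `≪ 1` on `(P^{0.5}η₋, P^{0.5}η₊]` (typed `Vk12SubVk1Small`, `Vk12SubVk1Edges`). The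
TRUE profile is much thinner, and that is what makes the absolute-value route to `hS` robust: with
`u = log y/log P`, `g = g_{𝓛³⁰}` ((4.1)),

  `ϰ₁(y)𝟙[y ≥ P^{1/2}] − ϰ₁₂(y) = (1/0.504)(P₁/y)^{β₆}·{[(0.504 − clamp(u;0.5,0.504)) − ∫_{0.5}^{0.504} g(P^z/y)dz]
      − 0.004·[𝟙[u < 0.5] − g(P^{0.5}/y)]}`

(`indicator_vk1_sub_vk12_eq`): a KINK term, `≤ ½√π·𝓛⁻²⁴` everywhere and `≤ 0.002·e^{−𝓛³⁰w²}` at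
log-distance `≥ w` from both `P^{1/2}` and `P₁` (tree `SmoothedStep.integral_step_crude/_middle/_left_far/
_right_far`), plus a JUMP term `0.004·|𝟙[y < P^{1/2}] − g(P^{0.5}/y)| ≤ 0.002·e^{−𝓛³⁰(log y − ½𝓛⁹)²}`
(tree `SmoothedStep.one_sub_step_bounds/step_le_majorant`, (4.2)/(4.3)). Results (`D ≥ 2`, `n ≥ 1`):

* `norm_indicator_vk1_sub_vk12_le` — `‖ϰ₁(n)𝟙[n ≥ P^{1/2}] − ϰ₁₂(n)‖ ≤ 2·𝓛⁻²⁴ + 0.004·e^{−𝓛³⁰(log n − 𝓛⁹/2)²}`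
  (`D ≥ 3`; exact form `norm_indicator_vk1_sub_vk12_le'`);
* `norm_indicator_vk1_sub_vk12_le_far` — `≤ 0.008·e^{−𝓛³⁰w²}` whenever `w ≤ |log n − 𝓛⁹/2|` and
  `w ≤ |log n − 0.504𝓛⁹|` (`w ≥ 0`);
* `norm_indicator_vk1_sub_vk12_le_global` — `≤ 0.005` (`𝓛 ≥ 2`);
* `b126_eq` — the literal `hS`-sequence of `eq126_of_sj_small` equals
  `χ(n)·(ϰ₁(n)𝟙[n ≥ P^{1/2}] − ϰ₁₂(n))` on the window `P^{0.5}η₋ < n < P₁η₊` and `0` off it, whence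
  `norm_b126_le` (`‖𝐛 n‖ ≤ ‖ϰ₁(n)𝟙 − ϰ₁₂(n)‖`) and `b126_eq_zero_of_not_window`.

So `𝐛` is `O(1)` only within log-distance `≈ 𝓛⁻¹⁵` of `P^{1/2}` (not on log-width `2𝓛⁻¹⁰`), `O(𝓛⁻²⁴)`
near `P₁`, and `≤ 0.008e^{−𝓛³⁰w²}` elsewhere — e.g. `≤ 0.008e^{−𝓛²}` at log-distance `𝓛⁻¹⁴`.
0 new definitions, 0 facts; standard axioms.

## References

* Y. Zhang, arXiv:2211.02515v1 (2022), §12 pp. 66–67 (tex L3386–L3408), (12.6); §4 (4.1)–(4.3);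
  §11 p. 63. [cite: Zhang2022LandauSiegel, §12 pp. 66–67]
-/

noncomputable section

open Complex Real ComplexConjugate MeasureTheory
open Literature.NumberTheory.LFunctions.Zhang2022
open Literature.NumberTheory.LFunctions.Zhang2022.Skeleton

namespace Literature.NumberTheory.LFunctions.Zhang2022.Typed.Sec12A

/-! ### Elementary rewrites -/

/-- `P^z = e^{𝓛⁹z}` ((2.6)). [cite: Zhang2022LandauSiegel, §2 (2.6)] -/
private theorem bigP_rpow_eq_exp (D : ℕ) (z : ℝ) : bigP D ^ z = Real.exp (ell D ^ 9 * z) := by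
  rw [bigP, ← Real.exp_mul]

/-- `g(P^z/y)` is the smoothed step of `Section11SmoothedStep` with `Λ = 𝓛³⁰`, `K = 𝓛⁹`.
[cite: Zhang2022LandauSiegel, §11 p. 63] -/
private theorem gW_bigP_rpow_div (D : ℕ) (y z : ℝ) :
    gW D (bigP D ^ z / y) = GaussWeight.gWeight (ell D ^ 30) (Real.exp (ell D ^ 9 * z) / y) := by
  rw [gW, bigP_rpow_eq_exp]

/-- `P^{1/2} ≤ y ⇔ 0.5 ≤ log y/𝓛⁹` (`y > 0`, `𝓛 > 0`). [cite: Zhang2022LandauSiegel, §2 (2.6)] -/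
private theorem half_le_iff {D : ℕ} (hK : 0 < ell D ^ 9) {y : ℝ} (hy : 0 < y) :
    bigP D ^ (1 / 2 : ℝ) ≤ y ↔ 0.5 ≤ Real.log y / ell D ^ 9 := by
  rw [bigP_rpow_eq_exp, le_div_iff₀ hK, ← Real.le_log_iff_exp_le hy]
  constructor <;> intro h <;> linarith

/-- `y < P₁ ⇔ log y/𝓛⁹ < 0.504` (`y > 0`, `𝓛 > 0`). [cite: Zhang2022LandauSiegel, §2 (2.21)] -/
private theorem lt_P1_iff {D : ℕ} (hK : 0 < ell D ^ 9) {y : ℝ} (hy : 0 < y) :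
    y < Skeleton.P1 D ↔ Real.log y / ell D ^ 9 < 0.504 := by
  rw [Skeleton.P1, bigP_rpow_eq_exp, div_lt_iff₀ hK, ← Real.log_lt_iff_lt_exp hy]
  constructor <;> intro h <;> linarith

/-! ### The real-variable core: kink term + jump term -/

/-- **The core estimate**: for `𝓛 > 0` and `y > 0`, with `u = log y/𝓛⁹`, `I = ∫_{0.5}^{0.504} g(P^z/y)dz`,
`g₀ = g(P^{0.5}/y)`:
`|(I − 0.004g₀) − ((0.504 − clamp(u;0.5,0.504)) − 0.004·𝟙[u<0.5])| ≤ ½√(π/(𝓛³⁰(𝓛⁹)²)) + 0.004·½e^{−𝓛³⁰(𝓛⁹·0.5 − log y)²}`.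
[cite: Zhang2022LandauSiegel, §12 p. 66, §11 p. 63, §4 (4.2)–(4.3)] -/
private theorem core_profile {D : ℕ} (hℓ : 0 < ell D) {y : ℝ} (hy : 0 < y) :
    |((∫ z in (0.5 : ℝ)..0.504, gW D (bigP D ^ z / y)) - 0.004 * gW D (bigP D ^ (0.5 : ℝ) / y)) -
        ((0.504 - max 0.5 (min (Real.log y / ell D ^ 9) 0.504)) -
          0.004 * (if Real.log y / ell D ^ 9 < 0.5 then (1 : ℝ) else 0))| ≤
      (1 / 2) * Real.sqrt (π / (ell D ^ 30 * (ell D ^ 9) ^ 2)) +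
        0.004 * ((1 / 2) * Real.exp (-(ell D ^ 30) * (ell D ^ 9 * 0.5 - Real.log y) ^ 2)) := by
  have hΛ : 0 < ell D ^ 30 := pow_pos hℓ 30
  have hK : 0 < ell D ^ 9 := pow_pos hℓ 9
  simp only [gW_bigP_rpow_div]
  have hI := SmoothedStep.integral_step_crude hΛ hK hy (a := 0.5) (b := 0.504) (by norm_num)
  set I : ℝ := ∫ z in (0.5 : ℝ)..0.504,
    GaussWeight.gWeight (ell D ^ 30) (Real.exp (ell D ^ 9 * z) / y) with hIdef
  set g₀ : ℝ := GaussWeight.gWeight (ell D ^ 30) (Real.exp (ell D ^ 9 * 0.5) / y) with hg₀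
  set c : ℝ := (1 / 2) * Real.sqrt (π / (ell D ^ 30 * (ell D ^ 9) ^ 2)) with hc
  set γ : ℝ := (1 / 2) * Real.exp (-(ell D ^ 30) * (ell D ^ 9 * 0.5 - Real.log y) ^ 2) with hγ
  set T : ℝ := 0.504 - max 0.5 (min (Real.log y / ell D ^ 9) 0.504) with hT
  by_cases hu : Real.log y / ell D ^ 9 < 0.5
  · -- below `P^{1/2}`: jump term `1 − g₀ ∈ [0, γ]`
    rw [if_pos hu, mul_one]
    obtain ⟨h1, h2⟩ := SmoothedStep.one_sub_step_bounds hΛ hK hy (z := 0.5) hu.le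
    have e : I - 0.004 * g₀ - (T - 0.004) = (I - T) + 0.004 * (1 - g₀) := by ring
    rw [e]
    calc |(I - T) + 0.004 * (1 - g₀)| ≤ |I - T| + |0.004 * (1 - g₀)| := abs_add_le _ _
      _ = |I - T| + 0.004 * (1 - g₀) := by rw [abs_of_nonneg (mul_nonneg (by norm_num) h1)]
      _ ≤ c + 0.004 * γ := by gcongr
  · -- above `P^{1/2}`: jump term `g₀ ∈ (0, γ]`
    rw [if_neg hu, mul_zero, sub_zero]
    have h2 := SmoothedStep.step_le_majorant hΛ hK hy (z := 0.5) (not_lt.mp hu)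
    have h1 : 0 < g₀ := GaussWeight.gWeight_pos hΛ _
    have e : I - 0.004 * g₀ - T = (I - T) - 0.004 * g₀ := by ring
    rw [e]
    calc |(I - T) - 0.004 * g₀| ≤ |I - T| + |0.004 * g₀| := abs_sub _ _
      _ = |I - T| + 0.004 * g₀ := by rw [abs_of_pos (mul_pos (by norm_num) h1)]
      _ ≤ c + 0.004 * γ := by gcongr

/-- **Far form of the core estimate**: if moreover `u` is at distance `≥ δ ≥ 0` from both `0.5` and
`0.504`, the kink term is `≤ 0.004·½e^{−𝓛³⁰(𝓛⁹δ)²}` and the jump term `≤ 0.004·½e^{−𝓛³⁰(𝓛⁹·0.5 − log y)²}`.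
[cite: Zhang2022LandauSiegel, §12 p. 66, §11 p. 63, §4 (4.2)–(4.3)] -/
private theorem core_profile_far {D : ℕ} (hℓ : 0 < ell D) {y : ℝ} (hy : 0 < y) {δ : ℝ} (hδ : 0 ≤ δ)
    (h5 : δ ≤ |Real.log y / ell D ^ 9 - 0.5|) (h504 : δ ≤ |Real.log y / ell D ^ 9 - 0.504|) :
    |((∫ z in (0.5 : ℝ)..0.504, gW D (bigP D ^ z / y)) - 0.004 * gW D (bigP D ^ (0.5 : ℝ) / y)) -
        ((0.504 - max 0.5 (min (Real.log y / ell D ^ 9) 0.504)) -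
          0.004 * (if Real.log y / ell D ^ 9 < 0.5 then (1 : ℝ) else 0))| ≤
      0.004 * ((1 / 2) * Real.exp (-(ell D ^ 30) * (ell D ^ 9 * δ) ^ 2)) +
        0.004 * ((1 / 2) * Real.exp (-(ell D ^ 30) * (ell D ^ 9 * 0.5 - Real.log y) ^ 2)) := by
  have hΛ : 0 < ell D ^ 30 := pow_pos hℓ 30
  have hK : 0 < ell D ^ 9 := pow_pos hℓ 9
  simp only [gW_bigP_rpow_div]
  set u : ℝ := Real.log y / ell D ^ 9 with hu_def
  set I : ℝ := ∫ z in (0.5 : ℝ)..0.504,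
    GaussWeight.gWeight (ell D ^ 30) (Real.exp (ell D ^ 9 * z) / y) with hIdef
  set g₀ : ℝ := GaussWeight.gWeight (ell D ^ 30) (Real.exp (ell D ^ 9 * 0.5) / y) with hg₀
  set E : ℝ := (1 / 2) * Real.exp (-(ell D ^ 30) * (ell D ^ 9 * δ) ^ 2) with hE
  set γ : ℝ := (1 / 2) * Real.exp (-(ell D ^ 30) * (ell D ^ 9 * 0.5 - Real.log y) ^ 2) with hγ
  set T : ℝ := 0.504 - max 0.5 (min u 0.504) with hT
  -- the kink term: three positions
  have hkink : |I - T| ≤ 0.004 * E := by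
    have hE0 : 0 ≤ E := by positivity
    rcases le_or_gt u (0.5 - δ) with hlo | hlo
    · -- far right of the whole interval: `u + δ ≤ 0.5`
      have hcl : max 0.5 (min u 0.504) = 0.5 :=
        max_eq_left (le_trans (min_le_left _ _) (by linarith))
      have h := SmoothedStep.integral_step_right_far hΛ hK hy hδ (a := 0.5) (b := 0.504)
        (by rw [← hu_def]; linarith) (by norm_num)
      rw [hT, hcl]
      have e : (0.504 : ℝ) - 0.5 = 0.004 := by norm_num
      rw [e] at h ⊢
      exact h
    · rcases lt_or_ge u (0.504 + δ) with hhi | hhi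
      · -- middle: `0.5 + δ ≤ u ≤ 0.504 − δ`
        have hu1 : 0.5 + δ ≤ u := by
          have : δ ≤ |u - 0.5| := h5
          rcases le_abs.mp this with h | h <;> [linarith; linarith]
        have hu2 : u ≤ 0.504 - δ := by
          have : δ ≤ |u - 0.504| := h504
          rcases le_abs.mp this with h | h <;> [linarith; linarith]
        have hcl : max 0.5 (min u 0.504) = u := by
          rw [min_eq_left (by linarith), max_eq_right (by linarith)]
        have h := SmoothedStep.integral_step_middle hΛ hK hy hδ (a := 0.5) (b := 0.504)
          (by rw [← hu_def]; linarith) (by rw [← hu_def]; linarith)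
        rw [hT, hcl]
        have e : (0.504 : ℝ) - 0.5 = 0.004 := by norm_num
        rw [e] at h
        rw [← hu_def] at h
        exact h
      · -- far left of the whole interval: `0.504 + δ ≤ u`
        have hcl : max 0.5 (min u 0.504) = 0.504 := by
          rw [min_eq_right (by linarith), max_eq_right (by norm_num)]
        have h := SmoothedStep.integral_step_left_far hΛ hK hy hδ (a := 0.5) (b := 0.504)
          (by norm_num) (by rw [← hu_def]; linarith)
        rw [hT, hcl, sub_self, sub_zero]
        have e : (0.504 : ℝ) - 0.5 = 0.004 := by norm_num
        rw [e] at h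
        exact h
  by_cases hu : u < 0.5
  · rw [if_pos hu, mul_one]
    obtain ⟨h1, h2⟩ := SmoothedStep.one_sub_step_bounds hΛ hK hy (z := 0.5) (by rw [← hu_def]; exact hu.le)
    have e : I - 0.004 * g₀ - (T - 0.004) = (I - T) + 0.004 * (1 - g₀) := by ring
    rw [e]
    calc |(I - T) + 0.004 * (1 - g₀)| ≤ |I - T| + |0.004 * (1 - g₀)| := abs_add_le _ _
      _ = |I - T| + 0.004 * (1 - g₀) := by rw [abs_of_nonneg (mul_nonneg (by norm_num) h1)]
      _ ≤ 0.004 * E + 0.004 * γ := by gcongr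
  · rw [if_neg hu, mul_zero, sub_zero]
    have h2 := SmoothedStep.step_le_majorant hΛ hK hy (z := 0.5) (by rw [← hu_def]; exact not_lt.mp hu)
    have h1 : 0 < g₀ := GaussWeight.gWeight_pos hΛ _
    have e : I - 0.004 * g₀ - T = (I - T) - 0.004 * g₀ := by ring
    rw [e]
    calc |(I - T) - 0.004 * g₀| ≤ |I - T| + |0.004 * g₀| := abs_sub _ _
      _ = |I - T| + 0.004 * g₀ := by rw [abs_of_pos (mul_pos (by norm_num) h1)]
      _ ≤ 0.004 * E + 0.004 * γ := by gcongr

/-! ### The identity for `ϰ₁𝟙 − ϰ₁₂` -/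

section Profile

variable {D : ℕ}

/-- **`ϰ₁(n)𝟙[n ≥ P^{1/2}] − ϰ₁₂(n) = (P₁/n)^{β₆}·(1/0.504)·{[(0.504 − clamp(u;0.5,0.504)) − 0.004𝟙[u<0.5]]
− [∫_{0.5}^{0.504} g(P^z/n)dz − 0.004 g(P^{0.5}/n)]}`**, `u = log n/𝓛⁹` (`D ≥ 2`, `n ≥ 1`): the
sharp coefficient `ϰ₁𝟙` is the clamp-plus-step combination, the smoothed one `ϰ₁₂` the same with
`g`-smoothed clamp and step (`log P₁ = 0.504𝓛⁹`, `∫_{0.5}^{0.504} g(P^{0.5}/n)dz = 0.004g(P^{0.5}/n)`).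
[cite: Zhang2022LandauSiegel, §12 p. 66 (tex L3386), §8 (8.6)] -/
theorem indicator_vk1_sub_vk12_eq (hD : 2 ≤ D) {n : ℕ} (hn : 1 ≤ n) :
    (if bigP D ^ (1 / 2 : ℝ) ≤ (n : ℝ) then vk1 D n else 0) - vk12 D n =
      ((Skeleton.P1 D / n : ℝ) : ℂ) ^ beta6 D *
        (((1 / 0.504 : ℝ) *
            (((0.504 - max 0.5 (min (Real.log n / ell D ^ 9) 0.504)) -
                0.004 * (if Real.log n / ell D ^ 9 < 0.5 then (1 : ℝ) else 0)) -
              ((∫ z in (0.5 : ℝ)..0.504, gW D (bigP D ^ z / n)) -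
                0.004 * gW D (bigP D ^ (0.5 : ℝ) / n))) : ℝ) : ℂ) := by
  have hℓ : 0 < ell D := ell_pos hD
  have hK : 0 < ell D ^ 9 := pow_pos hℓ 9
  have hy : (0 : ℝ) < n := by exact_mod_cast hn
  -- the integral of the difference
  have e : ∀ z : ℝ, gW D (bigP D ^ z / n) = gW D (Real.exp (ell D ^ 9 * z - Real.log n)) := by
    intro z
    rw [bigP, ← Real.exp_mul, Real.exp_sub, Real.exp_log hy]
  have hmono : Monotone fun z : ℝ => gW D (bigP D ^ z / n) := by
    intro z₁ z₂ hz
    simp only [e]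
    exact monotone_gW_exp hℓ (by nlinarith)
  have hint : IntervalIntegrable (fun z : ℝ => gW D (bigP D ^ z / n)) MeasureTheory.volume 0.5 0.504 :=
    hmono.intervalIntegrable
  have hI : ∫ z in (0.5 : ℝ)..0.504, (gW D (bigP D ^ z / n) - gW D (bigP D ^ (0.5 : ℝ) / n)) =
      (∫ z in (0.5 : ℝ)..0.504, gW D (bigP D ^ z / n)) -
        (0.504 - 0.5) * gW D (bigP D ^ (0.5 : ℝ) / n) := by
    rw [intervalIntegral.integral_sub hint intervalIntegrable_const, intervalIntegral.integral_const,
      smul_eq_mul]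
  set I₁ : ℝ := ∫ z in (0.5 : ℝ)..0.504, gW D (bigP D ^ z / n) with hI₁
  set g₀ : ℝ := gW D (bigP D ^ (0.5 : ℝ) / n) with hg₀
  set u : ℝ := Real.log n / ell D ^ 9 with hu
  have h04 : (0.504 : ℝ) - 0.5 = 0.004 := by norm_num
  rw [h04] at hI
  have hvk12 : vk12 D n = ((Skeleton.P1 D / n : ℝ) : ℂ) ^ beta6 D *
      (((1 / 0.504 : ℝ) * (I₁ - 0.004 * g₀) : ℝ) : ℂ) := by
    rw [vk12, hI]
    push_cast
    ring
  by_cases h1 : u < 0.5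
  · -- `n < P^{1/2}`: the indicator vanishes, the clamp is `0.5`
    have hnot : ¬ bigP D ^ (1 / 2 : ℝ) ≤ (n : ℝ) := by
      rw [half_le_iff hK hy]; exact not_le.mpr h1
    have hcl : max 0.5 (min u 0.504) = 0.5 := max_eq_left (le_trans (min_le_left _ _) h1.le)
    rw [if_neg hnot, hcl, if_pos h1, hvk12, zero_sub]
    push_cast
    ring
  · have hge : bigP D ^ (1 / 2 : ℝ) ≤ (n : ℝ) := by rw [half_le_iff hK hy]; exact not_lt.mp h1
    rw [if_pos hge, if_neg h1]
    by_cases h2 : u < 0.504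
    · -- `P^{1/2} ≤ n < P₁`: `ϰ₁(n) = (1/0.504)(0.504 − u)(P₁/n)^{β₆}`, clamp `= u`
      have hnP1 : (n : ℝ) < Skeleton.P1 D := by rw [lt_P1_iff hK hy]; exact h2
      have hcl : max 0.5 (min u 0.504) = u := by
        rw [min_eq_left h2.le, max_eq_right (not_lt.mp h1)]
      have hcoef : 1 - Real.log n / Real.log (Skeleton.P1 D) = 1 / 0.504 * (0.504 - u) := by
        rw [log_P1, hu]
        field_simp
      rw [vk1, if_pos hnP1, hcoef, hcl, hvk12]
      push_cast
      ring
    · -- `n ≥ P₁`: `ϰ₁(n) = 0`, clamp `= 0.504`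
      have hnP1 : ¬ (n : ℝ) < Skeleton.P1 D := by rw [lt_P1_iff hK hy]; exact h2
      have hcl : max 0.5 (min u 0.504) = 0.504 := by
        rw [min_eq_right (not_lt.mp h2), max_eq_right (by norm_num)]
      rw [vk1, if_neg hnP1, hcl, hvk12]
      push_cast
      ring

/-- **Sharp profile (exact constants)**: for `D ≥ 2`, `n ≥ 1`,
`‖ϰ₁(n)𝟙[n ≥ P^{1/2}] − ϰ₁₂(n)‖ ≤ (1/0.504)(½√(π/(𝓛³⁰(𝓛⁹)²)) + 0.002·e^{−𝓛³⁰(𝓛⁹·0.5 − log n)²})`.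
[cite: Zhang2022LandauSiegel, §12 pp. 66–67 (tex L3404–L3408)] -/
theorem norm_indicator_vk1_sub_vk12_le' (hD : 2 ≤ D) {n : ℕ} (hn : 1 ≤ n) :
    ‖(if bigP D ^ (1 / 2 : ℝ) ≤ (n : ℝ) then vk1 D n else 0) - vk12 D n‖ ≤
      (1 / 0.504) * ((1 / 2) * Real.sqrt (π / (ell D ^ 30 * (ell D ^ 9) ^ 2)) +
        0.002 * Real.exp (-(ell D ^ 30) * (ell D ^ 9 * 0.5 - Real.log n) ^ 2)) := by
  have hℓ : 0 < ell D := ell_pos hD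
  have hy : (0 : ℝ) < n := by exact_mod_cast hn
  have hP1 : 0 < Skeleton.P1 D := Real.rpow_pos_of_pos (Real.exp_pos _) _
  rw [indicator_vk1_sub_vk12_eq hD hn, norm_mul, norm_cpow_beta6 (div_pos hP1 hy), one_mul,
    Complex.norm_real, Real.norm_eq_abs, abs_mul, abs_of_pos (by norm_num : (0 : ℝ) < 1 / 0.504)]
  refine mul_le_mul_of_nonneg_left ?_ (by norm_num)
  rw [abs_sub_comm]
  have h := core_profile (D := D) hℓ hy
  calc _ ≤ (1 / 2) * Real.sqrt (π / (ell D ^ 30 * (ell D ^ 9) ^ 2)) +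
        0.004 * ((1 / 2) * Real.exp (-(ell D ^ 30) * (ell D ^ 9 * 0.5 - Real.log n) ^ 2)) := h
    _ = _ := by ring

/-- `½√(π/(𝓛³⁰(𝓛⁹)²)) = ½√π·𝓛⁻²⁴ ≤ 𝓛⁻²⁴` (`𝓛 > 0`, `π ≤ 4`). [folklore] -/
private theorem half_sqrt_le {D : ℕ} (hL : 0 < ell D) :
    (1 / 2) * Real.sqrt (π / (ell D ^ 30 * (ell D ^ 9) ^ 2)) ≤ (ell D ^ 24)⁻¹ := by
  have h48 : ell D ^ 30 * (ell D ^ 9) ^ 2 = (ell D ^ 24) ^ 2 := by ring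
  have hsq : Real.sqrt (π / (ell D ^ 30 * (ell D ^ 9) ^ 2)) ≤ 2 / ell D ^ 24 := by
    rw [h48]
    calc Real.sqrt (π / (ell D ^ 24) ^ 2) ≤ Real.sqrt ((2 / ell D ^ 24) ^ 2) := by
          apply Real.sqrt_le_sqrt
          rw [div_pow]
          exact div_le_div_of_nonneg_right (by nlinarith [Real.pi_lt_four]) (by positivity)
      _ = 2 / ell D ^ 24 := Real.sqrt_sq (by positivity)
  calc (1 / 2) * Real.sqrt (π / (ell D ^ 30 * (ell D ^ 9) ^ 2)) ≤ (1 / 2) * (2 / ell D ^ 24) := by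
        gcongr
    _ = (ell D ^ 24)⁻¹ := by ring

/-- **Sharp profile**: for `D ≥ 2`, `n ≥ 1`,
`‖ϰ₁(n)𝟙[n ≥ P^{1/2}] − ϰ₁₂(n)‖ ≤ 2·𝓛⁻²⁴ + 0.004·e^{−𝓛³⁰(log n − 𝓛⁹/2)²}` — a Gaussian of
log-width `𝓛⁻¹⁵` around `P^{1/2}` of height `0.004`, on top of the uniform kink error `2𝓛⁻²⁴`.
[cite: Zhang2022LandauSiegel, §12 pp. 66–67 (tex L3404–L3408)] -/
theorem norm_indicator_vk1_sub_vk12_le (hD : 2 ≤ D) {n : ℕ} (hn : 1 ≤ n) :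
    ‖(if bigP D ^ (1 / 2 : ℝ) ≤ (n : ℝ) then vk1 D n else 0) - vk12 D n‖ ≤
      2 * (ell D ^ 24)⁻¹ + 0.004 * Real.exp (-(ell D ^ 30) * (Real.log n - ell D ^ 9 / 2) ^ 2) := by
  have hℓ : 0 < ell D := ell_pos hD
  have h := norm_indicator_vk1_sub_vk12_le' hD hn
  have hc := half_sqrt_le hℓ
  have e : (ell D ^ 9 * 0.5 - Real.log n) ^ 2 = (Real.log n - ell D ^ 9 / 2) ^ 2 := by ring
  rw [e] at h
  have hpos : 0 ≤ Real.exp (-(ell D ^ 30) * (Real.log n - ell D ^ 9 / 2) ^ 2) := (Real.exp_pos _).le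
  have hinv : 0 ≤ (ell D ^ 24)⁻¹ := by positivity
  nlinarith

/-- **Sharp profile, global form**: for `D ≥ 2` with `𝓛 ≥ 2` and `n ≥ 1`,
`‖ϰ₁(n)𝟙[n ≥ P^{1/2}] − ϰ₁₂(n)‖ ≤ 0.005` (`2·2⁻²⁴ + 0.004`). [cite: Zhang2022LandauSiegel, §12 p. 67 (tex L3408, "≪ 1")] -/
theorem norm_indicator_vk1_sub_vk12_le_global (hD : 2 ≤ D) (hL : 2 ≤ ell D) {n : ℕ} (hn : 1 ≤ n) :
    ‖(if bigP D ^ (1 / 2 : ℝ) ≤ (n : ℝ) then vk1 D n else 0) - vk12 D n‖ ≤ 0.005 := by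
  have h := norm_indicator_vk1_sub_vk12_le hD hn
  have hexp : Real.exp (-(ell D ^ 30) * (Real.log n - ell D ^ 9 / 2) ^ 2) ≤ 1 := by
    rw [Real.exp_le_one_iff]
    have : 0 ≤ ell D ^ 30 * (Real.log n - ell D ^ 9 / 2) ^ 2 := by positivity
    linarith
  have hpow : (2 : ℝ) ^ 24 ≤ ell D ^ 24 := pow_le_pow_left₀ (by norm_num) hL 24
  have hinv : (ell D ^ 24)⁻¹ ≤ ((2 : ℝ) ^ 24)⁻¹ := inv_anti₀ (by positivity) hpow
  have h24 : ((2 : ℝ) ^ 24)⁻¹ ≤ 0.0005 := by norm_num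
  linarith

/-- **Sharp profile, far form**: for `D ≥ 2`, `n ≥ 1` and `0 ≤ w ≤ |log n − 𝓛⁹/2|`,
`w ≤ |log n − 0.504𝓛⁹|`: `‖ϰ₁(n)𝟙[n ≥ P^{1/2}] − ϰ₁₂(n)‖ ≤ 0.008·e^{−𝓛³⁰w²}` — off the two transition
layers the difference is Gaussian-small (e.g. `≤ 0.008e^{−𝓛²}` at log-distance `𝓛⁻¹⁴`, `≤ 0.008e^{−𝓛¹⁰}`
at log-distance `𝓛⁻¹⁰`, the printed `≪ ε` of p. 66). [cite: Zhang2022LandauSiegel, §12 pp. 66–67] -/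
theorem norm_indicator_vk1_sub_vk12_le_far (hD : 2 ≤ D) {n : ℕ} (hn : 1 ≤ n) {w : ℝ} (hw : 0 ≤ w)
    (h1 : w ≤ |Real.log n - ell D ^ 9 / 2|) (h2 : w ≤ |Real.log n - 0.504 * ell D ^ 9|) :
    ‖(if bigP D ^ (1 / 2 : ℝ) ≤ (n : ℝ) then vk1 D n else 0) - vk12 D n‖ ≤
      0.008 * Real.exp (-(ell D ^ 30) * w ^ 2) := by
  have hℓ : 0 < ell D := ell_pos hD
  have hK : 0 < ell D ^ 9 := pow_pos hℓ 9
  have hy : (0 : ℝ) < n := by exact_mod_cast hn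
  have hP1 : 0 < Skeleton.P1 D := Real.rpow_pos_of_pos (Real.exp_pos _) _
  -- margin in `u`-units: `δ = w/𝓛⁹`
  set δ : ℝ := w / ell D ^ 9 with hδ
  have hδ0 : 0 ≤ δ := div_nonneg hw hK.le
  have hKδ : ell D ^ 9 * δ = w := by rw [hδ]; field_simp
  have h5 : δ ≤ |Real.log n / ell D ^ 9 - 0.5| := by
    have e : Real.log n / ell D ^ 9 - 0.5 = (Real.log n - ell D ^ 9 / 2) / ell D ^ 9 := by
      field_simp; ring
    rw [e, abs_div, abs_of_pos hK, hδ]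
    exact div_le_div_of_nonneg_right h1 hK.le
  have h504 : δ ≤ |Real.log n / ell D ^ 9 - 0.504| := by
    have e : Real.log n / ell D ^ 9 - 0.504 = (Real.log n - 0.504 * ell D ^ 9) / ell D ^ 9 := by
      field_simp
    rw [e, abs_div, abs_of_pos hK, hδ]
    exact div_le_div_of_nonneg_right h2 hK.le
  rw [indicator_vk1_sub_vk12_eq hD hn, norm_mul, norm_cpow_beta6 (div_pos hP1 hy), one_mul,
    Complex.norm_real, Real.norm_eq_abs, abs_mul, abs_of_pos (by norm_num : (0 : ℝ) < 1 / 0.504),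
    abs_sub_comm]
  have h := core_profile_far (D := D) hℓ hy hδ0 h5 h504
  rw [hKδ] at h
  -- the jump Gaussian is also `≤ e^{−𝓛³⁰w²}` since `|𝓛⁹·0.5 − log n| ≥ w`
  have hgauss : Real.exp (-(ell D ^ 30) * (ell D ^ 9 * 0.5 - Real.log n) ^ 2) ≤
      Real.exp (-(ell D ^ 30) * w ^ 2) := by
    apply Real.exp_le_exp.mpr
    have hsq : w ^ 2 ≤ (ell D ^ 9 * 0.5 - Real.log n) ^ 2 := by
      have e : (ell D ^ 9 * 0.5 - Real.log n) ^ 2 = |Real.log n - ell D ^ 9 / 2| ^ 2 := by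
        rw [sq_abs]; ring
      rw [e]
      exact pow_le_pow_left₀ hw h1 2
    have hΛ : 0 ≤ ell D ^ 30 := by positivity
    nlinarith
  have hE : 0 ≤ Real.exp (-(ell D ^ 30) * w ^ 2) := (Real.exp_pos _).le
  calc 1 / 0.504 * _ ≤ 1 / 0.504 * (0.004 * ((1 / 2) * Real.exp (-(ell D ^ 30) * w ^ 2)) +
        0.004 * ((1 / 2) * Real.exp (-(ell D ^ 30) * (ell D ^ 9 * 0.5 - Real.log n) ^ 2))) :=
        mul_le_mul_of_nonneg_left h (by norm_num)
    _ ≤ 1 / 0.504 * (0.004 * ((1 / 2) * Real.exp (-(ell D ^ 30) * w ^ 2)) +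
        0.004 * ((1 / 2) * Real.exp (-(ell D ^ 30) * w ^ 2))) := by gcongr
    _ ≤ 0.008 * Real.exp (-(ell D ^ 30) * w ^ 2) := by nlinarith

/-- **Sharp profile, one-sided far form**: for `D ≥ 2`, `n ≥ 1` and `0 ≤ w ≤ |log n − 𝓛⁹/2|`:
`‖ϰ₁(n)𝟙[n ≥ P^{1/2}] − ϰ₁₂(n)‖ ≤ 2·𝓛⁻²⁴ + 0.004·e^{−𝓛³⁰w²}` (away from `P^{1/2}` only the kink error
`O(𝓛⁻²⁴)` survives, e.g. on the printed upper window `[P₁η₋, P₁η₊)`, where p. 67 says `≪ 𝓛⁻¹⁰`).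
[cite: Zhang2022LandauSiegel, §12 p. 67 (tex L3408)] -/
theorem norm_indicator_vk1_sub_vk12_le_of_far_half (hD : 2 ≤ D) {n : ℕ} (hn : 1 ≤ n) {w : ℝ}
    (hw : 0 ≤ w) (h1 : w ≤ |Real.log n - ell D ^ 9 / 2|) :
    ‖(if bigP D ^ (1 / 2 : ℝ) ≤ (n : ℝ) then vk1 D n else 0) - vk12 D n‖ ≤
      2 * (ell D ^ 24)⁻¹ + 0.004 * Real.exp (-(ell D ^ 30) * w ^ 2) := by
  have h := norm_indicator_vk1_sub_vk12_le hD hn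
  have hgauss : Real.exp (-(ell D ^ 30) * (Real.log n - ell D ^ 9 / 2) ^ 2) ≤
      Real.exp (-(ell D ^ 30) * w ^ 2) := by
    apply Real.exp_le_exp.mpr
    have hsq : w ^ 2 ≤ (Real.log n - ell D ^ 9 / 2) ^ 2 := by
      rw [← sq_abs (Real.log n - _)]
      exact pow_le_pow_left₀ hw h1 2
    have hΛ : 0 ≤ ell D ^ 30 := by positivity
    nlinarith
  linarith

end Profile

/-! ### The literal `hS`-sequence of `eq126_of_sj_small` -/

section Literal

variable {D : ℕ} (χ : DirichletCharacter ℂ D)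

/-- **The (12.6) coefficient sequence is `χ·(ϰ₁𝟙 − ϰ₁₂)` on the window `P^{0.5}η₋ < n < P₁η₊` and `0`
off it**: the literal first argument of `S_j` in the hypothesis `hS` of `eq126_of_sj_small`
(`H₁₅ − H̃₁₅`, §12 p. 66) rewritten (`D ≥ 2`; `ϰ₁(n) = 0` for `n ≥ P₁`, `η₋ < 1 ≤ η₊`).
[cite: Zhang2022LandauSiegel, §12 (12.6) p. 66] -/
theorem b126_eq (hD : 2 ≤ D) (n : ℕ) :
    ((if n ∈ (Finset.Ico 1 ⌈Skeleton.P1 D⌉₊).filter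
          (fun n : ℕ => ¬ (n : ℝ) < bigP D ^ (1 / 2 : ℝ))
        then χ (n : ZMod D) * vk1 D n else 0) -
      (if n ∈ (Finset.Ico 1 ⌈Skeleton.P1 D * etaPM D 1⌉₊).filter
          (fun n : ℕ => bigP D ^ (0.5 : ℝ) * etaPM D (-1) < n ∧
            (n : ℝ) < Skeleton.P1 D * etaPM D 1)
        then χ (n : ZMod D) * vk12 D n else 0)) =
      if bigP D ^ (0.5 : ℝ) * etaPM D (-1) < n ∧ (n : ℝ) < Skeleton.P1 D * etaPM D 1 then
        χ (n : ZMod D) * ((if bigP D ^ (1 / 2 : ℝ) ≤ (n : ℝ) then vk1 D n else 0) - vk12 D n)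
      else 0 := by
  have hℓ : 0 < ell D := ell_pos hD
  have hP0 : 0 < bigP D := Real.exp_pos _
  have hPh : 0 < bigP D ^ (0.5 : ℝ) := Real.rpow_pos_of_pos hP0 _
  have hP1 : 0 < Skeleton.P1 D := Real.rpow_pos_of_pos hP0 _
  have hhalf : bigP D ^ (1 / 2 : ℝ) = bigP D ^ (0.5 : ℝ) := by norm_num
  have hηm : etaPM D (-1) < 1 := by
    rw [etaPM, neg_one_mul]
    have h10 : 0 < (ell D ^ 10)⁻¹ := inv_pos.mpr (pow_pos hℓ 10)
    exact Real.exp_lt_one_iff.mpr (by linarith)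
  have hηp : 1 ≤ etaPM D 1 := by
    rw [etaPM, one_mul]; exact Real.one_le_exp (by positivity)
  simp only [Finset.mem_filter, Finset.mem_Ico]
  by_cases hW : bigP D ^ (0.5 : ℝ) * etaPM D (-1) < n ∧ (n : ℝ) < Skeleton.P1 D * etaPM D 1
  · rw [if_pos hW]
    obtain ⟨hW1, hW2⟩ := hW
    have hn0 : (0 : ℝ) < n := lt_trans (mul_pos hPh (Real.exp_pos _)) hW1
    have hn1 : 1 ≤ n := by exact_mod_cast Nat.one_le_iff_ne_zero.mpr (by
      rintro rfl; simp at hn0)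
    have hB : (1 ≤ n ∧ n < ⌈Skeleton.P1 D * etaPM D 1⌉₊) ∧
        (bigP D ^ (0.5 : ℝ) * etaPM D (-1) < n ∧ (n : ℝ) < Skeleton.P1 D * etaPM D 1) :=
      ⟨⟨hn1, Nat.lt_ceil.mpr hW2⟩, hW1, hW2⟩
    rw [if_pos hB]
    by_cases hge : bigP D ^ (1 / 2 : ℝ) ≤ (n : ℝ)
    · rw [if_pos hge]
      by_cases hP : (n : ℝ) < Skeleton.P1 D
      · have hA : (1 ≤ n ∧ n < ⌈Skeleton.P1 D⌉₊) ∧ ¬ (n : ℝ) < bigP D ^ (1 / 2 : ℝ) :=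
          ⟨⟨hn1, Nat.lt_ceil.mpr hP⟩, not_lt.mpr hge⟩
        rw [if_pos hA]; ring
      · have hv : vk1 D n = 0 := by rw [vk1, if_neg hP]
        rw [hv]
        split_ifs <;> ring
    · have hA : ¬ ((1 ≤ n ∧ n < ⌈Skeleton.P1 D⌉₊) ∧ ¬ (n : ℝ) < bigP D ^ (1 / 2 : ℝ)) := by
        rintro ⟨-, h⟩; exact h (not_le.mp hge)
      rw [if_neg hA, if_neg hge]; ring
  · rw [if_neg hW]
    have hB : ¬ ((1 ≤ n ∧ n < ⌈Skeleton.P1 D * etaPM D 1⌉₊) ∧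
        (bigP D ^ (0.5 : ℝ) * etaPM D (-1) < n ∧ (n : ℝ) < Skeleton.P1 D * etaPM D 1)) :=
      fun h => hW h.2
    rw [if_neg hB, sub_zero]
    -- off the window the first term vanishes too
    by_cases hA : (1 ≤ n ∧ n < ⌈Skeleton.P1 D⌉₊) ∧ ¬ (n : ℝ) < bigP D ^ (1 / 2 : ℝ)
    · rw [if_pos hA]
      obtain ⟨⟨hn1, -⟩, hge⟩ := hA
      rw [not_lt, hhalf] at hge
      -- `n ≥ P^{1/2} > P^{0.5}η₋`, so the window fails only if `n ≥ P₁η₊ ≥ P₁`: `ϰ₁(n) = 0`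
      have hlow : bigP D ^ (0.5 : ℝ) * etaPM D (-1) < n := by
        calc bigP D ^ (0.5 : ℝ) * etaPM D (-1) < bigP D ^ (0.5 : ℝ) * 1 := by gcongr
          _ = bigP D ^ (0.5 : ℝ) := mul_one _
          _ ≤ n := hge
      have hhigh : Skeleton.P1 D * etaPM D 1 ≤ n := by
        by_contra h
        exact hW ⟨hlow, not_le.mp h⟩
      have hP : ¬ (n : ℝ) < Skeleton.P1 D := by
        rw [not_lt]
        calc Skeleton.P1 D = Skeleton.P1 D * 1 := (mul_one _).symm
          _ ≤ Skeleton.P1 D * etaPM D 1 := by gcongr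
          _ ≤ n := hhigh
      rw [vk1, if_neg hP, mul_zero]
    · rw [if_neg hA]

/-- **Termwise: `‖𝐛 n‖ ≤ ‖ϰ₁(n)𝟙[n ≥ P^{1/2}] − ϰ₁₂(n)‖`** for the (12.6) coefficient sequence (`|χ| ≤ 1`),
`D ≥ 2`. [cite: Zhang2022LandauSiegel, §12 (12.6) p. 66] -/
theorem norm_b126_le (hD : 2 ≤ D) (n : ℕ) :
    ‖(if n ∈ (Finset.Ico 1 ⌈Skeleton.P1 D⌉₊).filter
          (fun n : ℕ => ¬ (n : ℝ) < bigP D ^ (1 / 2 : ℝ))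
        then χ (n : ZMod D) * vk1 D n else 0) -
      (if n ∈ (Finset.Ico 1 ⌈Skeleton.P1 D * etaPM D 1⌉₊).filter
          (fun n : ℕ => bigP D ^ (0.5 : ℝ) * etaPM D (-1) < n ∧
            (n : ℝ) < Skeleton.P1 D * etaPM D 1)
        then χ (n : ZMod D) * vk12 D n else 0)‖ ≤
      ‖(if bigP D ^ (1 / 2 : ℝ) ≤ (n : ℝ) then vk1 D n else 0) - vk12 D n‖ := by
  rw [b126_eq χ hD n]
  by_cases hW : bigP D ^ (0.5 : ℝ) * etaPM D (-1) < n ∧ (n : ℝ) < Skeleton.P1 D * etaPM D 1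
  · rw [if_pos hW, norm_mul]
    calc ‖χ (n : ZMod D)‖ * _ ≤ 1 * _ :=
          mul_le_mul_of_nonneg_right (DirichletCharacter.norm_le_one _ _) (norm_nonneg _)
      _ = _ := one_mul _
  · rw [if_neg hW, norm_zero]; exact norm_nonneg _

/-- **The (12.6) coefficient sequence vanishes off the window `P^{0.5}η₋ < n < P₁η₊`** (`D ≥ 2`).
[cite: Zhang2022LandauSiegel, §12 (12.6) p. 66] -/
theorem b126_eq_zero_of_not_window (hD : 2 ≤ D) {n : ℕ}
    (hn : ¬ (bigP D ^ (0.5 : ℝ) * etaPM D (-1) < n ∧ (n : ℝ) < Skeleton.P1 D * etaPM D 1)) :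
    ((if n ∈ (Finset.Ico 1 ⌈Skeleton.P1 D⌉₊).filter
          (fun n : ℕ => ¬ (n : ℝ) < bigP D ^ (1 / 2 : ℝ))
        then χ (n : ZMod D) * vk1 D n else 0) -
      (if n ∈ (Finset.Ico 1 ⌈Skeleton.P1 D * etaPM D 1⌉₊).filter
          (fun n : ℕ => bigP D ^ (0.5 : ℝ) * etaPM D (-1) < n ∧
            (n : ℝ) < Skeleton.P1 D * etaPM D 1)
        then χ (n : ZMod D) * vk12 D n else 0)) = 0 := by
  rw [b126_eq χ hD n, if_neg hn]

/-- **Termwise sharp profile of the (12.6) coefficients**: for `D ≥ 2` and every `n ≥ 1`,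
`‖𝐛 n‖ ≤ 2·𝓛⁻²⁴ + 0.004·e^{−𝓛³⁰(log n − 𝓛⁹/2)²}`. [cite: Zhang2022LandauSiegel, §12 pp. 66–67] -/
theorem norm_b126_le_profile (hD : 2 ≤ D) {n : ℕ} (hn : 1 ≤ n) :
    ‖(if n ∈ (Finset.Ico 1 ⌈Skeleton.P1 D⌉₊).filter
          (fun n : ℕ => ¬ (n : ℝ) < bigP D ^ (1 / 2 : ℝ))
        then χ (n : ZMod D) * vk1 D n else 0) -
      (if n ∈ (Finset.Ico 1 ⌈Skeleton.P1 D * etaPM D 1⌉₊).filter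
          (fun n : ℕ => bigP D ^ (0.5 : ℝ) * etaPM D (-1) < n ∧
            (n : ℝ) < Skeleton.P1 D * etaPM D 1)
        then χ (n : ZMod D) * vk12 D n else 0)‖ ≤
      2 * (ell D ^ 24)⁻¹ + 0.004 * Real.exp (-(ell D ^ 30) * (Real.log n - ell D ^ 9 / 2) ^ 2) :=
  le_trans (norm_b126_le χ hD n) (norm_indicator_vk1_sub_vk12_le hD hn)

/-- **Termwise far bound of the (12.6) coefficients**: for `D ≥ 2`, `n ≥ 1`, `0 ≤ w`,
`w ≤ |log n − 𝓛⁹/2|`, `w ≤ |log n − 0.504𝓛⁹|`: `‖𝐛 n‖ ≤ 0.008·e^{−𝓛³⁰w²}`.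
[cite: Zhang2022LandauSiegel, §12 pp. 66–67] -/
theorem norm_b126_le_far (hD : 2 ≤ D) {n : ℕ} (hn : 1 ≤ n) {w : ℝ} (hw : 0 ≤ w)
    (h1 : w ≤ |Real.log n - ell D ^ 9 / 2|) (h2 : w ≤ |Real.log n - 0.504 * ell D ^ 9|) :
    ‖(if n ∈ (Finset.Ico 1 ⌈Skeleton.P1 D⌉₊).filter
          (fun n : ℕ => ¬ (n : ℝ) < bigP D ^ (1 / 2 : ℝ))
        then χ (n : ZMod D) * vk1 D n else 0) -
      (if n ∈ (Finset.Ico 1 ⌈Skeleton.P1 D * etaPM D 1⌉₊).filter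
          (fun n : ℕ => bigP D ^ (0.5 : ℝ) * etaPM D (-1) < n ∧
            (n : ℝ) < Skeleton.P1 D * etaPM D 1)
        then χ (n : ZMod D) * vk12 D n else 0)‖ ≤
      0.008 * Real.exp (-(ell D ^ 30) * w ^ 2) :=
  le_trans (norm_b126_le χ hD n) (norm_indicator_vk1_sub_vk12_le_far hD hn hw h1 h2)

/-- **Termwise one-sided bound of the (12.6) coefficients** (away from `P^{1/2}` only): for `D ≥ 2`,
`n ≥ 1`, `0 ≤ w ≤ |log n − 𝓛⁹/2|`: `‖𝐛 n‖ ≤ 2·𝓛⁻²⁴ + 0.004·e^{−𝓛³⁰w²}`.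
[cite: Zhang2022LandauSiegel, §12 p. 67 (tex L3408)] -/
theorem norm_b126_le_of_far_half (hD : 2 ≤ D) {n : ℕ} (hn : 1 ≤ n) {w : ℝ} (hw : 0 ≤ w)
    (h1 : w ≤ |Real.log n - ell D ^ 9 / 2|) :
    ‖(if n ∈ (Finset.Ico 1 ⌈Skeleton.P1 D⌉₊).filter
          (fun n : ℕ => ¬ (n : ℝ) < bigP D ^ (1 / 2 : ℝ))
        then χ (n : ZMod D) * vk1 D n else 0) -
      (if n ∈ (Finset.Ico 1 ⌈Skeleton.P1 D * etaPM D 1⌉₊).filter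
          (fun n : ℕ => bigP D ^ (0.5 : ℝ) * etaPM D (-1) < n ∧
            (n : ℝ) < Skeleton.P1 D * etaPM D 1)
        then χ (n : ZMod D) * vk12 D n else 0)‖ ≤
      2 * (ell D ^ 24)⁻¹ + 0.004 * Real.exp (-(ell D ^ 30) * w ^ 2) :=
  le_trans (norm_b126_le χ hD n) (norm_indicator_vk1_sub_vk12_le_of_far_half hD hn hw h1)

/-- **Termwise global bound of the (12.6) coefficients**: `‖𝐛 n‖ ≤ 0.005` for all `n`
(`D ≥ 2`, `𝓛 ≥ 2`). [cite: Zhang2022LandauSiegel, §12 p. 67 (tex L3408, "≪ 1")] -/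
theorem norm_b126_le_global (hD : 2 ≤ D) (hL : 2 ≤ ell D) (n : ℕ) :
    ‖(if n ∈ (Finset.Ico 1 ⌈Skeleton.P1 D⌉₊).filter
          (fun n : ℕ => ¬ (n : ℝ) < bigP D ^ (1 / 2 : ℝ))
        then χ (n : ZMod D) * vk1 D n else 0) -
      (if n ∈ (Finset.Ico 1 ⌈Skeleton.P1 D * etaPM D 1⌉₊).filter
          (fun n : ℕ => bigP D ^ (0.5 : ℝ) * etaPM D (-1) < n ∧
            (n : ℝ) < Skeleton.P1 D * etaPM D 1)
        then χ (n : ZMod D) * vk12 D n else 0)‖ ≤ 0.005 := by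
  rcases Nat.eq_zero_or_pos n with rfl | hn
  · rw [b126_eq_zero_of_not_window χ hD, norm_zero]
    · norm_num
    · rintro ⟨h, -⟩
      have h0 : (0 : ℝ) < bigP D ^ (0.5 : ℝ) * etaPM D (-1) :=
        mul_pos (Real.rpow_pos_of_pos (Real.exp_pos _) _) (Real.exp_pos _)
      have : ((0 : ℕ) : ℝ) = 0 := Nat.cast_zero
      linarith
  · exact le_trans (norm_b126_le χ hD n) (norm_indicator_vk1_sub_vk12_le_global hD hL hn)

end Literal

end Literature.NumberTheory.LFunctions.Zhang2022.Typed.Sec12A
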